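import Summits.Ventures.PercRepro.CoreFinalBridge
import Summits.Ventures.PercRepro.SevenThreeCoreFinal
import Summits.Ventures.PercRepro.RLSRuleEightThree

/-!
# PercRepro — C-025 at `q = 3` through the small-corank core cells (p2, gen 12)

The second, independent reading of the `q = 3` row (lead (rr)(1)): p2's reduction `c025_three_of_core_seven_eight`
composed with p3's `(7,3)` core theorem `rls_seven_three_of_core` and night-3's `(8,3)` core theorem
`rls_core_of_eight_le`. The first reading is p3's `c025_three_all` (night-3's reduction `c025_three_of_seven`);
both prove the same statement from the same two core theorems.

* **`c025_three_all'`** — `ThmN.RLS M p 3` for every finite matroid `M` and every `p ≥ 5`.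
Imports `CoreFinalBridge`, `SevenThreeCoreFinal`, `RLSRuleEightThree`. Axioms: standard.
-/

namespace PercRepro
namespace CoreFour

/-- **C-025 at `q = 3` on every finite matroid, every `p ≥ 5`**, through the small-corank core cells of `CoreFinal`. -/
theorem c025_three_all' {α : Type} (M : Matroid α) [M.Finite] (p : ℕ) (hp : 5 ≤ p) : ThmN.RLS M p 3 :=
  c025_three_of_core_seven_eight
    (fun M _ hc => by classical exact SevenThree.rls_seven_three_of_core hc)
    (fun M _ hc => NightThree.rls_core_of_eight_le M le_rfl hc) M p hp

end CoreFour
end PercRepro
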